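import Literature.MathematicalPhysics.QuantumFieldTheory.Balaban1983to89.B11Eq103H1Complex

/-!
# `Balaban1983to89.B9Eq3124GaugeModes` — T. Bałaban, *Propagators for lattice gauge theories in a background field*, Commun. Math.
# Phys. **99** (1985) 389–434 [Balaban1985BackgroundPropagators] (3.21)–(3.23) p. 394, (3.124) p. 420, p. 425, (3.152) p. 426, with
# [Balaban1985Variational] (110)–(111) p. 294: THE PROJECTION `R` OF (3.21) IS DETERMINED BY ITS RANGE, AND THE (3.124)-IDENTITIES
# `QG₁DR = 0`, `RD*G₁Q* = 0`, `RD*G₁DR = R` AT THE CONSTRUCTED `R` FROM TWO GAUGE-MODE FACTS ABOUT THE DATA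

statement-level skeleton of published theorems with citation tags; proofs where landed; nothing here is a claim
about the Yang–Mills mass gap

PDF held: `paper:balaban1985-cmp99-background-propagators` (journal page = PDF page + 388), `paper:balaban1985-cmp102-variational-background`
(journal page = PDF page + 276); pp. 393–394, 420, 425–426 / 294 read by this seat (2026-08-21) in the held text layers.

THE PRINT (verbatim).
* [B9] p. 394: *«where R = R(U) is an orthogonal projection in the Hilbert space L²(Ω₀, 𝔤) onto the subspace ℛ = Δ^η_U N(Q′),
  N(Q′) = {λ : Q′λ = 0}. (3.21) For an arbitrary function f ∈ L²(Ω₀, 𝔤) we have Rf = Δ^η_U λ₀, where λ₀ is a minimum of the function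
  λ ∈ N(Q′), λ → ‖f − Δ^η_U λ‖². (3.22)»*; p. 393: *«if u = e^{iλ}, then the part of this transformation linear in A and λ is given by
  A_λ = A − Dλ»*.
* [B9] p. 420: *«We will prove that the second term in the last line vanishes. More exactly we will prove the identities RD*GQ* = 0, hence
  QGDR = 0. (3.124)»*; p. 425: *«Verifying the above properties we need to know only the identities (3.124) and RD*G₁DR = R»*; p. 426:
  *«G₁DR = DG′R. (3.152) Let us notice that these identities imply the identities (3.124), because QG₁DR = QDG′R = D₁Q′G′R = 0»*.
* [B11] p. 294: *«In [5] we have proved that the operator G₁𝔓* is equal to the operator 𝔊 defined by (3.148) and satisfying the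
  equalities Q𝔊 = 0, RD*𝔊 = 0.»*

WHY THIS FILE (cell context).  pub-balaban NE9 letter map (B2′): `B11Eq103H1Complex` (the row owner's FILE 1, p292856) CONSTRUCTS `R` of
(3.21) as `projR Δs Q′` / `RLatticeK c R S Q′` and keeps the three (3.124)-type identities as DISPLAYED letters `h124`, `h124'`, `hRDR`
of `Q_frakGLatticeK` / `RDstar_frakGLatticeK` / `frakGLatticeCLM_mem_constraint102`.  The owner's WORD W-ne9p1-g77-1 (pub-balaban
CLAIMS.log l.33737) invited the sequel «(g3)/(g4) ⇒ `h124`/`hRDR`» on the landed letters; this file is that sequel (XREAD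
C-ne9leaf01g67-1): at the constructed `R` the identities follow from two facts about the DATA — (g1) the Hessian `Δ₁` kills the
`Q′`-invisible gauge modes `Dλ`, (g2) the averaging `Q` does — and, for `RD*G₁Q* = 0`, the symmetric setting the owner's file
already proves (`D* = D†`, `R` symmetric, `Δ_{1,a}` symmetric).

WHAT IS PROVED (sorry-free; theorems only; no definition, no `Prop` placeholder, no inequality of the papers).
* §1 `R` of (3.21) is DETERMINED by the API of `B11Eq103H1Complex`: `range_projR` (`range R = Δs N(Q′)`, (3.21)–(3.22)),
  `inner_sub_projR_eq_zero` (`f − Rf ⊥ ℛ`), `projR_apply_eq_zero_iff` (`Rf = 0 ↔ f ⊥ ℛ`), **`projR_unique`** (any symmetric linear `P`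
  with range in `ℛ` fixing `ℛ` equals `projR` — print's «the orthogonal projection onto ℛ»); `range_RLatticeK`.
* §2 (abstract `RCLike` Hilbert level, the letters of `B11Eq103H1Complex.laplaceAK`/`G1K`): for a set `N` of gauge parameters with
  (g1) `Δ(Dλ) = 0`, (g2) `Q(Dλ) = 0`, (g3) `R(D*Dλ) = D*Dλ` (λ ∈ N) and (g4) `∀ s, ∃ λ ∈ N, Rs = D*Dλ`:
  `laplaceAK_gaugeMode` (`Δ_{1,a}(Dλ) = DD*Dλ`), `G1K_gaugeMode` (`G₁(DD*Dλ) = Dλ`), **`apply_Q_G1K_D_R`** ((3.124) `QG₁DR = 0`),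
  **`apply_R_Dstar_G1K_D_R`** (p. 425 `RD*G₁DR = R`); `greenK_isSymmetric`, `G1K_isSymmetric`.
* §3 AT THE LATTICE WITH `Rr := RLatticeK c R S Q′` ((g3) = `RLatticeK_apply_of_ker`, (g4) = `exists_ker_projR_eq` — theorems of the
  owner's file): **`h124_RLatticeK`**, **`hRDR_RLatticeK`** from (g1)+(g2) alone; `G1LatticeK_isSymmetric`; **`h124'_RLatticeK`**
  (`RD*G₁Q† = 0`) from (g1)+(g2) in the symmetric setting — print's «RD*GQ* = 0, hence QGDR = 0» read backwards,
  `⟪RD*G₁Q†y, t⟫ = ⟪y, QG₁DRt⟫ = 0`; whence `Q_frakGLatticeK_of_gaugeModes`, `RDstar_frakGLatticeK_of_gaugeModes`, and in the (115)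
  reading (`𝕜 = ℂ`) **`frakGLatticeCLM_mem_constraint102_of_gaugeModes`**: the constructed `𝔊` lies in the constraint subspace
  (102) given `hpos`, `hQ`, `conj c = c`, mutually adjoint transporters, `Δ₁` symmetric, (g1), (g2) — letters on the DATA only.

MODEL / DECLARED READINGS.  (M1) as in `B11Eq103H1Complex` (fibre, transporters, weights).  (M2) DISPLAYED, never asserted: `hpos`
([B9] Thm 3.11), `hQ` ((3.19) onto), and the two gauge-mode facts (g1) `∀ λ, Q′λ = 0 → Δ₁(Dλ) = 0` (invariance of `⟨A, Δ₁A⟩` under the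
linearized gauge transformations `A ↦ A − Dλ` of p. 393 — a property of the DATA `Δ₁`; it is NOT claimed here for the Wilson Hessian
(3.10)/(3.12) at a general background) and (g2) `∀ λ, Q′λ = 0 → Q(Dλ) = 0` (the intertwining «QD = D₁Q′» of p. 426 / [B9] (3.115) on
`N(Q′)`).  (M3) NOT HERE: print's OWN proof of (3.124) — the Gaussian-integral identities (3.121)/(3.125) p. 420 and (3.150)–(3.152)
p. 426 (`G₁DR = DG′R`) — which needs neither (g1) nor symmetry; this file gives ONE sufficient algebraic route, not the print's.
HONEST SCOPE.  [folklore] finite-dimensional Hilbert-space algebra over the owner's constructed letters; no estimate of the papers; NOT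
summit progress (cell pub-balaban: NE9 NOT PRINTED / NOT PROVED; spine PROVED 0/9).  Filed (if at all) by the pub-balaban NE9 leaf
lineage `b2b-balaban-t4-ne9-formalise-leaf-01` (gen 67) on the row owner's request; a NEW file importing `B11Eq103H1Complex` only;
nothing of the owner's or of lit-balaban's is modified.  Net new unproved facts: 0.
-/

noncomputable section

open scoped InnerProductSpace ComplexConjugate BigOperators

namespace Literature.MathematicalPhysics.QuantumFieldTheory.Balaban1983to89.B9Eq3124GaugeModes

open B11Eq103H1Complex

/-! ## §1 `R` of (3.21) is determined by its range -/

section Projection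

variable {𝕜 : Type*} [RCLike 𝕜] {E : Type*} [NormedAddCommGroup E] [InnerProductSpace 𝕜 E] [FiniteDimensional 𝕜 E]
  {F' : Type*} [AddCommGroup F'] [Module 𝕜 F']

/-- **(3.21)–(3.22): `range R = ℛ = Δ^η_U N(Q′)` exactly** — `⊆` is (3.22) (`B11Eq103H1Complex.exists_ker_projR_eq`), `⊇` is (3.21)
(`B11Eq103H1Complex.projR_apply_of_ker`). [cite: Balaban1985BackgroundPropagators, (3.21)-(3.22) p.394] -/
theorem range_projR (Δs : E →ₗ[𝕜] E) (Q' : E →ₗ[𝕜] F') :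
    LinearMap.range (projR Δs Q') = (LinearMap.ker Q').map Δs := by
  refine le_antisymm ?_ ?_
  · rintro _ ⟨f, rfl⟩
    obtain ⟨l, hl, h⟩ := exists_ker_projR_eq Δs Q' f
    rw [h]
    exact Submodule.mem_map_of_mem (LinearMap.mem_ker.2 hl)
  · rintro _ ⟨l, hl, rfl⟩
    exact ⟨Δs l, projR_apply_of_ker Δs Q' (LinearMap.mem_ker.1 hl)⟩

/-- `f − Rf ⊥ ℛ`: the residual of the orthogonal projection is orthogonal to `Δ_U N(Q′)` (from symmetry + (3.21)).
[cite: Balaban1985BackgroundPropagators, (3.21)-(3.22) p.394] -/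
theorem inner_sub_projR_eq_zero (Δs : E →ₗ[𝕜] E) (Q' : E →ₗ[𝕜] F') (f : E) {l : E} (hl : Q' l = 0) :
    ⟪f - projR Δs Q' f, Δs l⟫_𝕜 = 0 := by
  rw [inner_sub_left, ← projR_apply_of_ker Δs Q' hl, ← projR_isSymmetric Δs Q', projR_apply_of_ker Δs Q' hl, sub_self]

/-- **The kernel of `R` is `ℛ^⊥`**: `Rf = 0 ↔ ⟪Δ_U λ, f⟫ = 0` for all `λ ∈ N(Q′)`. [cite: Balaban1985BackgroundPropagators, (3.21) p.394] -/
theorem projR_apply_eq_zero_iff (Δs : E →ₗ[𝕜] E) (Q' : E →ₗ[𝕜] F') (f : E) :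
    projR Δs Q' f = 0 ↔ ∀ l : E, Q' l = 0 → ⟪Δs l, f⟫_𝕜 = 0 := by
  constructor
  · intro h l hl
    rw [← projR_apply_of_ker Δs Q' hl, projR_isSymmetric Δs Q', h, inner_zero_right]
  · intro h
    obtain ⟨l₀, hl₀, h₀⟩ := exists_ker_projR_eq Δs Q' f
    have : ⟪projR Δs Q' f, projR Δs Q' f⟫_𝕜 = 0 := by
      rw [← projR_isSymmetric Δs Q' (projR Δs Q' f) f, projR_projR, h₀, h l₀ hl₀]
    exact inner_self_eq_zero.1 this

/-- **Print's «the orthogonal projection … onto the subspace ℛ» pins `R` down**: any symmetric linear `P` whose range lies in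
`ℛ = Δs N(Q′)` and which fixes `ℛ` equals `B11Eq103H1Complex.projR Δs Q′`. [cite: Balaban1985BackgroundPropagators, (3.21) p.394] -/
theorem projR_unique (Δs : E →ₗ[𝕜] E) (Q' : E →ₗ[𝕜] F') (P : E →ₗ[𝕜] E) (hP : P.IsSymmetric)
    (hrange : ∀ f : E, ∃ l : E, Q' l = 0 ∧ P f = Δs l) (hfix : ∀ l : E, Q' l = 0 → P (Δs l) = Δs l) :
    P = projR Δs Q' := by
  ext f
  obtain ⟨l₁, hl₁, h₁⟩ := hrange f
  obtain ⟨l₂, hl₂, h₂⟩ := exists_ker_projR_eq Δs Q' f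
  have hPorth : ∀ l : E, Q' l = 0 → ⟪f - P f, Δs l⟫_𝕜 = 0 := fun l hl => by
    rw [inner_sub_left, ← hfix l hl, ← hP, hfix l hl, sub_self]
  have hdiff : P f - projR Δs Q' f = Δs (l₁ - l₂) := by rw [h₁, h₂, map_sub]
  have hker : Q' (l₁ - l₂) = 0 := by rw [map_sub, hl₁, hl₂, sub_self]
  have h0 : ⟪P f - projR Δs Q' f, P f - projR Δs Q' f⟫_𝕜 = 0 := by
    have e : P f - projR Δs Q' f = (f - projR Δs Q' f) - (f - P f) := by abel
    calc ⟪P f - projR Δs Q' f, P f - projR Δs Q' f⟫_𝕜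
        = ⟪(f - projR Δs Q' f) - (f - P f), Δs (l₁ - l₂)⟫_𝕜 := by rw [← e, hdiff]
      _ = 0 := by rw [inner_sub_left, inner_sub_projR_eq_zero Δs Q' f hker, hPorth _ hker, sub_self]
  exact sub_eq_zero.1 (inner_self_eq_zero.1 h0)

end Projection

/-! ## §2 The (3.124)-identities from gauge-mode structure (abstract `RCLike` Hilbert level) -/

section GaugeModes

variable {𝕜 : Type*} [RCLike 𝕜] {E : Type*} [NormedAddCommGroup E] [InnerProductSpace 𝕜 E] [FiniteDimensional 𝕜 E]
  {F : Type*} [NormedAddCommGroup F] [InnerProductSpace 𝕜 F] {S : Type*} [AddCommGroup S] [Module 𝕜 S]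
  {Δ : E →ₗ[𝕜] E} {D : S →ₗ[𝕜] E} {R : S →ₗ[𝕜] S} {Dstar : E →ₗ[𝕜] S} {Q : E →ₗ[𝕜] F} {Qadj : F →ₗ[𝕜] E} {a : 𝕜}

omit [FiniteDimensional 𝕜 E] in
/-- On a gauge mode `Dλ` with (g1) `Δ(Dλ) = 0`, (g2) `Q(Dλ) = 0`, (g3) `R(D*Dλ) = D*Dλ`: `Δ_{1,a}(Dλ) = D(D*(Dλ))` ([B9] (3.26) `Δ_a = Δ + DRD* + Q*aQ`).
[cite: Balaban1985BackgroundPropagators, (3.26) p.395] -/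
theorem laplaceAK_gaugeMode (N : Set S) (g1 : ∀ l ∈ N, Δ (D l) = 0) (g2 : ∀ l ∈ N, Q (D l) = 0)
    (g3 : ∀ l ∈ N, R (Dstar (D l)) = Dstar (D l)) {l : S} (hl : l ∈ N) :
    laplaceAK Δ D R Dstar Q Qadj a (D l) = D (Dstar (D l)) := by
  rw [laplaceAK_apply, g1 l hl, g2 l hl, g3 l hl, smul_zero, map_zero, zero_add, add_zero]

variable (hpos : ∀ x : E, x ≠ 0 → 0 < RCLike.re ⟪x, laplaceAK Δ D R Dstar Q Qadj a x⟫_𝕜)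

/-- Hence `G₁(D(D*(Dλ))) = Dλ` for such gauge modes (the operator form of [B9] (3.152) `G₁DR = DG′R` on `ℛ`).
[cite: Balaban1985BackgroundPropagators, (3.152) p.426] -/
theorem G1K_gaugeMode (N : Set S) (g1 : ∀ l ∈ N, Δ (D l) = 0) (g2 : ∀ l ∈ N, Q (D l) = 0)
    (g3 : ∀ l ∈ N, R (Dstar (D l)) = Dstar (D l)) {l : S} (hl : l ∈ N) :
    G1K Δ D R Dstar Q Qadj a hpos (D (Dstar (D l))) = D l := by
  rw [← laplaceAK_gaugeMode (Qadj := Qadj) (a := a) N g1 g2 g3 hl, G1K_laplaceAK]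

/-- **(3.124) `QG₁DR = 0`** from (g1)–(g4) — print p. 426: «QG₁DR = QDG′R = D₁Q′G′R = 0».
[cite: Balaban1985BackgroundPropagators, (3.124) p.420] -/
theorem apply_Q_G1K_D_R (N : Set S) (g1 : ∀ l ∈ N, Δ (D l) = 0) (g2 : ∀ l ∈ N, Q (D l) = 0)
    (g3 : ∀ l ∈ N, R (Dstar (D l)) = Dstar (D l)) (g4 : ∀ s : S, ∃ l ∈ N, R s = Dstar (D l)) (s : S) :
    Q (G1K Δ D R Dstar Q Qadj a hpos (D (R s))) = 0 := by
  obtain ⟨l, hl, hs⟩ := g4 s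
  rw [hs, G1K_gaugeMode hpos N g1 g2 g3 hl, g2 l hl]

/-- **p. 425 `RD*G₁DR = R`** from (g1)–(g4). [cite: Balaban1985BackgroundPropagators, p.425] -/
theorem apply_R_Dstar_G1K_D_R (N : Set S) (g1 : ∀ l ∈ N, Δ (D l) = 0) (g2 : ∀ l ∈ N, Q (D l) = 0)
    (g3 : ∀ l ∈ N, R (Dstar (D l)) = Dstar (D l)) (g4 : ∀ s : S, ∃ l ∈ N, R s = Dstar (D l)) (s : S) :
    R (Dstar (G1K Δ D R Dstar Q Qadj a hpos (D (R s)))) = R s := by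
  obtain ⟨l, hl, hs⟩ := g4 s
  rw [hs, G1K_gaugeMode hpos N g1 g2 g3 hl, g3 l hl]

omit hpos in
/-- The inverse `T⁻¹` (`B11Eq103H1Complex.greenK`) of a SYMMETRIC operator with positive definite real part is symmetric.
[cite: Balaban1985BackgroundPropagators, Thm 3.11 p.416] -/
theorem greenK_isSymmetric {T : E →ₗ[𝕜] E} (hposT : ∀ x : E, x ≠ 0 → 0 < RCLike.re ⟪x, T x⟫_𝕜) (hT : T.IsSymmetric) :
    (greenK T hposT).IsSymmetric := fun x y => by
  have h := hT (greenK T hposT x) (greenK T hposT y)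
  rw [apply_greenK, apply_greenK] at h
  exact h.symm

/-- `G₁` is symmetric when `Δ_{1,a}` is ([B11] p. 293's scalar product «defined by the operator Δ₁ + D*RD + aQ*Q»).
[cite: Balaban1985Variational, p.293] -/
theorem G1K_isSymmetric (hL : (laplaceAK Δ D R Dstar Q Qadj a).IsSymmetric) : (G1K Δ D R Dstar Q Qadj a hpos).IsSymmetric :=
  greenK_isSymmetric hpos hL

end GaugeModes

/-! ## §3 At the lattice with the CONSTRUCTED `Rr := RLatticeK c R S Q′` -/

section Lattice

open B9SectCLatticeCarrier (Bond)
open B4Sect5Torus (TSite)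

variable {𝕜 : Type*} [RCLike 𝕜] {d : ℕ} {Pd : Fin d → ℕ} {W : Type*} [NormedAddCommGroup W] [InnerProductSpace 𝕜 W]
  [FiniteDimensional 𝕜 W] {c₀ : ℝ} [Fact (0 < c₀)] {F : Type*} [NormedAddCommGroup F] [InnerProductSpace 𝕜 F] [FiniteDimensional 𝕜 F]
  {F' : Type*} [AddCommGroup F'] [Module 𝕜 F']
  {c : 𝕜} {R S : Bond d Pd → W →ₗ[𝕜] W} {Δ₁ : BondL2K 𝕜 d Pd c₀ W →ₗ[𝕜] BondL2K 𝕜 d Pd c₀ W}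
  {Q : BondL2K 𝕜 d Pd c₀ W →ₗ[𝕜] F} {a : ℝ} {Q' : SiteL2K 𝕜 d Pd c₀ W →ₗ[𝕜] F'}

/-- **`range R = D*D N(Q′)` for the lattice `R` of (3.21).** [cite: Balaban1985BackgroundPropagators, (3.21)-(3.23) p.394] -/
theorem range_RLatticeK : LinearMap.range (RLatticeK c R S Q') = (LinearMap.ker Q').map (covLaplaceSiteK c R S) :=
  range_projR _ _

variable (hpos : ∀ x : BondL2K 𝕜 d Pd c₀ W, x ≠ 0 → 0 < RCLike.re ⟪x, laplaceALatticeK c R S Δ₁ (RLatticeK c R S Q') Q a x⟫_𝕜)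

/-- **(3.124) `QG₁DR = 0` AT THE CONSTRUCTED `R`**, from (g1) `Δ₁(Dλ) = 0` and (g2) `Q(Dλ) = 0` on `N(Q′)` alone ((g3)/(g4) are
`RLatticeK_apply_of_ker` / `exists_ker_projR_eq`) — the letter `h124` of `B11Eq103H1Complex.Q_frakGLatticeK`, DISCHARGED.
[cite: Balaban1985BackgroundPropagators, (3.124) p.420] -/
theorem h124_RLatticeK (g1 : ∀ l : SiteL2K 𝕜 d Pd c₀ W, Q' l = 0 → Δ₁ (covDerivL2K 𝕜 c₀ c R l) = 0)
    (g2 : ∀ l : SiteL2K 𝕜 d Pd c₀ W, Q' l = 0 → Q (covDerivL2K 𝕜 c₀ c R l) = 0) (s : SiteL2K 𝕜 d Pd c₀ W) :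
    Q (G1LatticeK hpos (covDerivL2K 𝕜 c₀ c R (RLatticeK c R S Q' s))) = 0 :=
  apply_Q_G1K_D_R hpos {l | Q' l = 0} g1 g2 (fun _ hl => RLatticeK_apply_of_ker c R S Q' hl)
    (fun s => by obtain ⟨l, hl, h⟩ := exists_ker_projR_eq (covLaplaceSiteK c R S) Q' s; exact ⟨l, hl, h⟩) s

/-- **p. 425 `RD*G₁DR = R` AT THE CONSTRUCTED `R`**, from (g1), (g2) — the letter `hRDR` of `B11Eq103H1Complex.RDstar_frakGLatticeK`,
DISCHARGED. [cite: Balaban1985BackgroundPropagators, p.425] -/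
theorem hRDR_RLatticeK (g1 : ∀ l : SiteL2K 𝕜 d Pd c₀ W, Q' l = 0 → Δ₁ (covDerivL2K 𝕜 c₀ c R l) = 0)
    (g2 : ∀ l : SiteL2K 𝕜 d Pd c₀ W, Q' l = 0 → Q (covDerivL2K 𝕜 c₀ c R l) = 0) (s : SiteL2K 𝕜 d Pd c₀ W) :
    RLatticeK c R S Q' (covDivL2K 𝕜 c₀ c S (G1LatticeK hpos (covDerivL2K 𝕜 c₀ c R (RLatticeK c R S Q' s)))) =
      RLatticeK c R S Q' s :=
  apply_R_Dstar_G1K_D_R hpos {l | Q' l = 0} g1 g2 (fun _ hl => RLatticeK_apply_of_ker c R S Q' hl)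
    (fun s => by obtain ⟨l, hl, h⟩ := exists_ker_projR_eq (covLaplaceSiteK c R S) Q' s; exact ⟨l, hl, h⟩) s

/-- `G₁` of the lattice is symmetric at the constructed `R` when `Δ₁` is (`laplaceALatticeK_isSymmetric` + `RLatticeK_isSymmetric`).
[cite: Balaban1985Variational, p.293] -/
theorem G1LatticeK_isSymmetric (hc : conj c = c) (hRS : ∀ (b : Bond d Pd) (v u : W), ⟪R b v, u⟫_𝕜 = ⟪v, S b u⟫_𝕜)
    (hΔ : Δ₁.IsSymmetric) : (G1LatticeK hpos).IsSymmetric :=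
  G1K_isSymmetric hpos (laplaceALatticeK_isSymmetric hc hRS hΔ (RLatticeK_isSymmetric c R S Q'))

/-- **(3.124) `RD*G₁Q* = 0` AT THE CONSTRUCTED `R`** in the symmetric setting (`conj c = c`, mutually adjoint transporters, `Δ₁`
symmetric), from (g1), (g2): print's «RD*GQ* = 0, hence QGDR = 0» read backwards — `⟪RD*G₁Q†y, t⟫ = ⟪y, QG₁DRt⟫ = 0` by
`RLatticeK_isSymmetric`, `adjoint_covDerivL2K` (`D* = D†`), `G1LatticeK_isSymmetric`. The letter `h124'`, DISCHARGED.
[cite: Balaban1985BackgroundPropagators, (3.124) p.420] -/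
theorem h124'_RLatticeK (hc : conj c = c) (hRS : ∀ (b : Bond d Pd) (v u : W), ⟪R b v, u⟫_𝕜 = ⟪v, S b u⟫_𝕜)
    (hΔ : Δ₁.IsSymmetric) (g1 : ∀ l : SiteL2K 𝕜 d Pd c₀ W, Q' l = 0 → Δ₁ (covDerivL2K 𝕜 c₀ c R l) = 0)
    (g2 : ∀ l : SiteL2K 𝕜 d Pd c₀ W, Q' l = 0 → Q (covDerivL2K 𝕜 c₀ c R l) = 0) (y : F) :
    RLatticeK c R S Q' (covDivL2K 𝕜 c₀ c S (G1LatticeK hpos (LinearMap.adjoint Q y))) = 0 := by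
  have key : ∀ t : SiteL2K 𝕜 d Pd c₀ W,
      ⟪RLatticeK c R S Q' (covDivL2K 𝕜 c₀ c S (G1LatticeK hpos (LinearMap.adjoint Q y))), t⟫_𝕜 = 0 := fun t => by
    rw [RLatticeK_isSymmetric c R S Q', ← adjoint_covDerivL2K c hc R S hRS, LinearMap.adjoint_inner_left,
      G1LatticeK_isSymmetric hpos hc hRS hΔ, LinearMap.adjoint_inner_left, h124_RLatticeK hpos g1 g2 t, inner_zero_right]
  exact inner_self_eq_zero.1 (key _)

variable (hQ : Function.Surjective Q)

/-- **`Q𝔊 = 0`** ([B11] p. 294) for the constructed `𝔊 = frakGLatticeK` at `Rr := RLatticeK`, with NO displayed (3.124)-letter.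
[cite: Balaban1985Variational, p.294] -/
theorem Q_frakGLatticeK_of_gaugeModes (g1 : ∀ l : SiteL2K 𝕜 d Pd c₀ W, Q' l = 0 → Δ₁ (covDerivL2K 𝕜 c₀ c R l) = 0)
    (g2 : ∀ l : SiteL2K 𝕜 d Pd c₀ W, Q' l = 0 → Q (covDerivL2K 𝕜 c₀ c R l) = 0) (x : BondL2K 𝕜 d Pd c₀ W) :
    Q (frakGLatticeK hpos hQ x) = 0 :=
  Q_frakGLatticeK hpos hQ (h124_RLatticeK hpos g1 g2) x

/-- **`RD*𝔊 = 0`** ([B11] p. 294) for the constructed `𝔊` at `Rr := RLatticeK` in the symmetric setting, with NO displayed letter.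
[cite: Balaban1985Variational, p.294] -/
theorem RDstar_frakGLatticeK_of_gaugeModes (hc : conj c = c) (hRS : ∀ (b : Bond d Pd) (v u : W), ⟪R b v, u⟫_𝕜 = ⟪v, S b u⟫_𝕜)
    (hΔ : Δ₁.IsSymmetric) (g1 : ∀ l : SiteL2K 𝕜 d Pd c₀ W, Q' l = 0 → Δ₁ (covDerivL2K 𝕜 c₀ c R l) = 0)
    (g2 : ∀ l : SiteL2K 𝕜 d Pd c₀ W, Q' l = 0 → Q (covDerivL2K 𝕜 c₀ c R l) = 0) (x : BondL2K 𝕜 d Pd c₀ W) :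
    RLatticeK c R S Q' (covDivL2K 𝕜 c₀ c S (frakGLatticeK hpos hQ x)) = 0 :=
  RDstar_frakGLatticeK hpos hQ (h124'_RLatticeK hpos hc hRS hΔ g1 g2) (hRDR_RLatticeK hpos g1 g2) x

end Lattice

/-! ### The (115) reading (`𝕜 = ℂ`): `frakGLatticeCLM ∈ constraint102` with all three letters discharged -/

section Carrier

open B11Eq115Space B11Eq111FrakG
open B9Eq311L2Pairing (WL2)
open B9SectCLatticeCarrier (Bond)
open B4Sect5Torus (TSite)

variable {d : ℕ} {Pd : Fin d → ℕ} {β κ : Type*} [Fintype β] [Fintype κ] {V : Type*} [NormedAddCommGroup V] [NormedSpace ℂ V]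
  [FiniteDimensional ℂ V] {W : Type*} [NormedAddCommGroup W] [InnerProductSpace ℂ W] [FiniteDimensional ℂ W] (φ : W ≃ₗ[ℂ] V)
  {L η : ℝ} [Fact (0 < L)] [Fact (0 < η)] {lev₀ : Bond d Pd → ℕ} {levB : β → ℕ} {c₀ : ℝ} [Fact (0 < c₀)] {wB : β → ℝ} [Fact (∀ y, 0 < wB y)]
  {F' : Type*} [AddCommGroup F'] [Module ℂ F']
  {c : ℂ} {R S : Bond d Pd → W →ₗ[ℂ] W} {Δ₁ : BondL2K ℂ d Pd c₀ W →ₗ[ℂ] BondL2K ℂ d Pd c₀ W}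
  {Q : BondL2K ℂ d Pd c₀ W →ₗ[ℂ] WL2 ℂ wB W} {a : ℝ} {Q' : SiteL2K ℂ d Pd c₀ W →ₗ[ℂ] F'}
  (hpos : ∀ x : BondL2K ℂ d Pd c₀ W, x ≠ 0 → 0 < RCLike.re ⟪x, laplaceALatticeK c R S Δ₁ (RLatticeK c R S Q') Q a x⟫_ℂ)
  (hQ : Function.Surjective Q)

/-- **The constructed `𝔊` in the (115) reading lies in the constraint subspace (102)** — `B11Eq103H1Complex.frakGLatticeCLM_mem_constraint102`
with `h124`, `h124'`, `hRDR` ALL DISCHARGED at `Rr := RLatticeK c R S Q′` from `conj c = c`, mutually adjoint transporters, `Δ₁` symmetric and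
the gauge-mode facts (g1), (g2). [cite: Balaban1985Variational, (110)-(111) p.294] -/
theorem frakGLatticeCLM_mem_constraint102_of_gaugeModes (lev₁ : κ → ℕ) (Dc : (Bond d Pd → V) →ₗ[ℂ] (κ → V))
    (hc : conj c = c) (hRS : ∀ (b : Bond d Pd) (v u : W), ⟪R b v, u⟫_ℂ = ⟪v, S b u⟫_ℂ) (hΔ : Δ₁.IsSymmetric)
    (g1 : ∀ l : SiteL2K ℂ d Pd c₀ W, Q' l = 0 → Δ₁ (covDerivL2K ℂ c₀ c R l) = 0)
    (g2 : ∀ l : SiteL2K ℂ d Pd c₀ W, Q' l = 0 → Q (covDerivL2K ℂ c₀ c R l) = 0) (f : NegSize L η lev₀ 3 V) :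
    frakGLatticeCLM (L := L) (η := η) (lev₀ := lev₀) φ hpos hQ lev₁ Dc f ∈
      constraint102 lev₁ Dc (QFun φ Q) (RLatticeK c R S Q') (DstarFun φ (covDivL2K ℂ c₀ c S)) :=
  frakGLatticeCLM_mem_constraint102 φ hpos hQ lev₁ Dc (h124_RLatticeK hpos g1 g2) (h124'_RLatticeK hpos hc hRS hΔ g1 g2)
    (hRDR_RLatticeK hpos g1 g2) f

end Carrier

end Literature.MathematicalPhysics.QuantumFieldTheory.Balaban1983to89.B9Eq3124GaugeModes

end
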